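import Mathlib
import HarnessLib
import Literature.Combinatorics.SimpleGraph.ChordalGraph
import Literature.Combinatorics.SimpleGraph.MaximumCardinalitySearch
import Literature.Combinatorics.SimpleGraph.EliminationGraph

/-!
# Minimal triangulations of a graph: the unique-chord characterisation
(Rose–Tarjan–Lueker 1976, §2: Lemma 1, Corollary 1, Lemma 2, Theorems 1 and 2)

Sequel of `Literature.Combinatorics.SimpleGraph.ChordalGraph` (chordal graphs `IsChordal`,
chordless cycles, simplicial vertices, Dirac's lemma, chordal = has a perfect elimination
ordering) and `Literature.Combinatorics.SimpleGraph.EliminationGraph` (the elimination graph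
`G*_σ` of an ordered graph; every chordal supergraph contains one).  A TRIANGULATION (chordal
completion) of `G` is a chordal `H ⊇ G` on the same vertices; it is MINIMAL if no graph strictly
between `G` and `H` is chordal.  All graphs are `_root_.SimpleGraph V`; "`H − uv`" is
`H.deleteEdges {s(u, v)}`, "`H − x`" is `H.induce {x}ᶜ`.

## Contents

* `IsTriangulation G H`, `IsMinimalTriangulation G H` (`:= Minimal (IsTriangulation G) H`),
  `isMinimalTriangulation_iff`; `IsTriangulation.exists_isMinimalTriangulation_le`,
  `exists_isMinimalTriangulation` (finite vertex type: a minimal triangulation exists below every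
  triangulation).
* **The single-edge deletion criterion** behind [RTL76, Thm 2]: for an edge `uv` of a chordal
  `H`, `IsChordal.deleteEdges_of_forall_adj` / `forall_adj_of_isChordal_deleteEdges` — `H − uv`
  is chordal iff the common neighbours of `u`, `v` are pairwise adjacent — and
  `IsChordal.isChordal_deleteEdges_iff : IsChordal (H − uv) ↔ ¬ IsUniqueChordOfFourCycle H u v`
  (a chordless cycle of `H − uv` is a cycle of `H` whose ONLY chord is `uv`; the two arcs cut off
  by the chord are chordless cycles of `H` unless both have length `3`).
* `addDeficiency G x = G + D(x)` — the neighbourhood of `x` made complete (the DEFICIENCY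
  `D(x)` of [RTL76, §1] added; `(G + D(x)) − x` is the `x`-elimination graph `G_x`);
  **`monotoneTransitive_addDeficiency` = [RTL76, LEMMA 1]** (a perfect elimination ordering of
  `G` is one of `G + D(x)`), `isChordal_addDeficiency`, **`IsChordal.eliminationGraph` =
  [RTL76, COROLLARY 1]** (`G` chordal ⟹ `G_x` chordal),
  `isSimplicial_addDeficiency_of_isSimplicial`.
* `isChordal_of_isSimplicial_of_induce_compl` (`x` simplicial and `H − x` chordal ⟹ `H` chordal).
* **`IsChordal.exists_isChordal_deleteEdges` = [RTL76, LEMMA 2]**: if `G ⊊ H` are both chordal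
  (finite), some edge of `H ∖ G` can be deleted from `H` keeping it chordal — proved as in the
  report by induction on `|V|` through the `x`-elimination graphs of a simplicial vertex `x` of `H`.
* **`isMinimalTriangulation_iff_forall_not_isChordal_deleteEdges` = [RTL76, THEOREM 1]**
  (minimal iff no single edge of `H ∖ G` can be deleted keeping chordality) and
  **`isMinimalTriangulation_iff_forall_isUniqueChordOfFourCycle` = [RTL76, THEOREM 2]**
  (minimal iff every edge of `H ∖ G` is the unique chord of a `4`-cycle of `H`).
* Orderings: `isTriangulation_elimGraph` (every `G*_σ` is a triangulation),
  `IsMinimalTriangulation.exists_linearOrder_eq_elimGraph` (every minimal triangulation is some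
  `G*_σ`), `IsMinimalOrdering` (no ordering has a strictly smaller fill),
  `isMinimalOrdering_iff_isMinimalTriangulation` ("`α` is a minimal ordering iff `F(G_α)` is a
  minimal triangulation") and `isMinimalOrdering_iff_forall_isUniqueChordOfFourCycle`
  ([RTL76, Thm 2] verbatim: `α` is minimal iff each fill edge is the unique chord of a `4`-cycle
  of `G*_α`).

NOT here: [RTL76, Cor. 2] (a perfect ordering starting at any vertex of empty deficiency — our
proof of Lemma 2 uses simplicial vertices and induced subgraphs directly instead), minimum
orderings / minimum fill-in and its NP-completeness (Yannakakis 1981), the algorithms LEX P /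
LEX M of [RTL76, §§3–5] and MCS-M, counting or listing minimal triangulations, and the later
characterisations of minimal triangulations by minimal separators (Parra–Scheffler,
Heggernes' 2006 survey).

## References (keys of `lean/references.bib`)

* [RTL76] D. J. Rose, R. E. Tarjan, G. S. Lueker, *Algorithmic aspects of vertex elimination on
  graphs*, SIAM J. Comput. 5 (1976) 266–283, doi:10.1137/0205021 (bib: RoseTarjanLueker1976).
  Numbering and page numbers follow the REPORT VERSION held as `lit` key
  `paper:doi-10-1137-0205021` (D. J. Rose, R. E. Tarjan, 1974; text checked): §1 p. 3 (deficiency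
  `D(v) = {{x,y} | v—x, v—y, x ≠ y, x ⌿ y}`, elimination graph
  `G_v = (V − {v}, E(V − {v}) ∪ D(v))`),
  p. 4 (perfect / minimal / minimum elimination orderings; "any elimination graph `G*_α` is a
  perfect elimination graph"), p. 5 ("a set of edges `F` is a triangulation if `G' = (V, E ∪ F)`
  is triangulated.  `F` is a minimal triangulation if `G_q = (V, E ∪ F_q)` is not triangulated for
  any `F_q ⊊ F`"); §2 pp. 7–8 Lemma 1 ("Let `α` be a perfect elimination ordering of a
  triangulated graph `G`.  Let `x ∈ V`.  Then `α` is also a perfect ordering of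
  `G' = (V, E ∪ D(x))`"), p. 8 Corollary 1 ("If `G` is triangulated and `x` is any vertex, the
  elimination graph `G_x` is triangulated"), p. 8 Lemma 2 ("Let `G = (V,E)` be triangulated, and
  `G' = (V, E ∪ F)` with `F ≠ ∅`, `E ∩ F = ∅` be also triangulated.  Then there exists some `f ∈ F`
  such that `G' − f` is triangulated"; proof by induction on `n = |V|`, cases (i)/(ii)), p. 9
  Theorem 1 ("`F` is a minimal triangulation iff for each `f ∈ F`, `G' − f` is not
  triangulated") and Theorem 2 ("`F` is a minimal triangulation iff each `f ∈ F` is a unique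
  chord of a `4`-cycle in `G'`"), p. 10 ("`α` is a minimal ordering iff `F(G_α)` is a minimal
  triangulation").
-/

namespace Literature.Combinatorics.SimpleGraph

open Literature.LinearAlgebra.Matrix.ChordalSparsity (MonotoneTransitive)

universe u

variable {V : Type u}

/-! ### Triangulations and minimal triangulations -/

/-- `H` is a TRIANGULATION (chordal completion, chordal embedding) of `G`: a chordal graph on the
same vertex set containing `G` — "For an arbitrary graph `G = (V,E)` a set of edges `F` is a
triangulation if `G' = (V, E ∪ F)` is triangulated" (here `H = G'`; the FILL is `E(H) ∖ E(G)`).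
[cite: RoseTarjanLueker1976, §1 (p. 5 of the report)] -/
structure IsTriangulation (G H : _root_.SimpleGraph V) : Prop where
  le : G ≤ H
  isChordal : IsChordal H

/-- `H` is a MINIMAL TRIANGULATION of `G`: a triangulation such that no graph strictly between
`G` and `H` is chordal — "`F` is a minimal triangulation if `G_q = (V, E ∪ F_q)` is not
triangulated for any `F_q ⊊ F`".  Stated with Mathlib's `Minimal`.
[cite: RoseTarjanLueker1976, §1 (p. 5 of the report)] -/
def IsMinimalTriangulation (G H : _root_.SimpleGraph V) : Prop :=
  Minimal (IsTriangulation G) H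

variable {G H : _root_.SimpleGraph V}

/-- Unfolding: `H` is a minimal triangulation of `G` iff it is a triangulation and every chordal
`H'` with `G ≤ H' ≤ H` equals `H`. [cite: RoseTarjanLueker1976, §1 (p. 5 of the report)] -/
theorem isMinimalTriangulation_iff :
    IsMinimalTriangulation G H ↔
      IsTriangulation G H ∧ ∀ ⦃H'⦄, G ≤ H' → H' ≤ H → IsChordal H' → H' = H := by
  constructor
  · rintro ⟨hT, hmin⟩
    exact ⟨hT, fun H' hGH' hH'H hH' => le_antisymm hH'H (hmin ⟨hGH', hH'⟩ hH'H)⟩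
  · rintro ⟨hT, hmin⟩
    exact ⟨hT, fun H' hT' hH'H => (hmin hT'.le hH'H hT'.isChordal).ge⟩

/-- A chordal graph is its own (unique minimal) triangulation.
[cite: RoseTarjanLueker1976, §1 (p. 5 of the report)] -/
theorem IsChordal.isMinimalTriangulation_self (hG : IsChordal G) : IsMinimalTriangulation G G :=
  ⟨⟨le_rfl, hG⟩, fun _ hT' _ => hT'.le⟩

/-- The complete graph is chordal. [folklore] -/
private theorem isChordal_top : IsChordal (⊤ : _root_.SimpleGraph V) := by
  intro k c hc
  have hk := hc.four_le
  haveI : NeZero k := ⟨by omega⟩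
  -- the "chord" `{c 0, c 2}`
  have h02 : (c 0) ≠ (c 2) := fun h => by
    have := hc.injective h
    rw [Fin.ext_iff, Fin.val_zero] at this
    simp [Nat.mod_eq_of_lt (show 2 < k by omega)] at this
  rcases hc.no_chord ((SimpleGraph.top_adj _ _).2 h02) with h | h
  · rw [finRotate_apply, Fin.ext_iff] at h
    simp [Nat.mod_eq_of_lt (show 2 < k by omega), Nat.mod_eq_of_lt (show 1 < k by omega)] at h
  · rw [finRotate_apply, Fin.ext_iff] at h
    simp [Fin.val_add, Nat.mod_eq_of_lt (show 2 < k by omega),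
      Nat.mod_eq_of_lt (show 3 < k by omega)] at h

/-- Every finite graph has a minimal triangulation below any given triangulation (the set of
graphs on a finite vertex type is finite). [cite: RoseTarjanLueker1976, §1 (p. 5 of the report)] -/
theorem IsTriangulation.exists_isMinimalTriangulation_le [Finite V] (hH : IsTriangulation G H) :
    ∃ H' ≤ H, IsMinimalTriangulation G H' :=
  exists_minimal_le_of_wellFoundedLT (IsTriangulation G) H hH

/-- Every finite graph has a minimal triangulation.
[cite: RoseTarjanLueker1976, §1 (p. 5 of the report)] -/
theorem exists_isMinimalTriangulation [Finite V] (G : _root_.SimpleGraph V) :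
    ∃ H, IsMinimalTriangulation G H := by
  obtain ⟨H, -, hH⟩ := (IsTriangulation.mk le_top isChordal_top : IsTriangulation G ⊤)
    |>.exists_isMinimalTriangulation_le
  exact ⟨H, hH⟩

/-! ### Deleting one edge from a chordal graph

The criterion behind [RTL76, Thm 2]: for an edge `uv` of a chordal graph `H`, the graph `H − uv`
is chordal iff `uv` is not the unique chord of a `4`-cycle of `H`, i.e. iff the common neighbours
of `u` and `v` are pairwise adjacent.  (A chordless cycle of `H − uv` is a cycle of `H` whose only
chord is `uv`; the two arcs it cuts off are then chordless cycles of `H` unless both have length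
`3`, so the cycle is a `4`-cycle `u x v y` with `xy ∉ E(H)`.) -/

section DeleteEdge

variable {u v : V}

/-- Adjacency in `H − uv`. [folklore] -/
private theorem deleteEdges_singleton_adj {a b : V} :
    (H.deleteEdges {s(u, v)}).Adj a b ↔ H.Adj a b ∧ s(a, b) ≠ s(u, v) := by
  rw [SimpleGraph.deleteEdges_adj, Set.mem_singleton_iff]

/-- The value of `finRotate n x`: `x + 1`, wrapping around at `n`. [folklore] -/
private theorem val_finRotate {n : ℕ} (x : Fin n) :
    ((finRotate n x : Fin n) : ℕ) = if (x : ℕ) + 1 = n then 0 else (x : ℕ) + 1 := by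
  obtain ⟨m, rfl⟩ : ∃ m, n = m + 1 := ⟨n - 1, (Nat.succ_pred_eq_of_pos x.pos).symm⟩
  rw [coe_finRotate]
  simp only [Fin.ext_iff, Fin.val_last]
  split_ifs <;> omega

/-- Re-indexing a chordless cycle from another starting point `i₀`. [folklore] -/
private theorem IsChordlessCycle.rotate {k : ℕ} [NeZero k] {c : Fin k → V}
    (hc : IsChordlessCycle G c) (i₀ : Fin k) : IsChordlessCycle G (fun m => c (m + i₀)) where
  four_le := hc.four_le
  injective := hc.injective.comp (add_left_injective i₀)
  adj_next m := by
    have h := hc.adj_next (m + i₀)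
    simp only [finRotate_apply] at h ⊢
    rwa [add_right_comm]
  no_chord a b h := by
    rcases hc.no_chord h with h' | h'
    · left
      rw [finRotate_apply] at h' ⊢
      exact add_right_cancel (h'.trans (add_right_comm a i₀ 1))
    · right
      rw [finRotate_apply] at h' ⊢
      exact add_right_cancel (h'.trans (add_right_comm b i₀ 1))

/-- The core of the criterion: a chordless cycle `c` of `H − uv` (indexed by `Fin (n + 1)`) with an
`H`-chord from position `0` to a non-neighbouring position `j` is impossible when `H` is chordal
and the common neighbours of `u`, `v` are pairwise adjacent. [folklore] -/
private theorem deleteEdges_aux (hH : IsChordal H) {n : ℕ} {c : Fin (n + 1) → V}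
    (hc : IsChordlessCycle (H.deleteEdges {s(u, v)}) c) {j : Fin (n + 1)}
    (hchord : H.Adj (c 0) (c j)) (hj1 : j ≠ 1) (hjn : j + 1 ≠ 0)
    (hclique : ∀ ⦃x y⦄, H.Adj u x → H.Adj v x → H.Adj u y → H.Adj v y → x ≠ y → H.Adj x y) :
    False := by
  classical
  have hk := hc.four_le
  -- the position of the far end of the chord, read in `ℕ`
  set d : ℕ := (j : ℕ) with hd
  have hdn : d < n + 1 := j.isLt
  have h1v : ((1 : Fin (n + 1)) : ℕ) = 1 := by
    rw [Fin.val_one', Nat.mod_eq_of_lt (by omega)]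
  have hd1 : d ≠ 1 := fun h => hj1 (Fin.ext (by rw [h1v]; exact h))
  have hdn' : d ≠ n := by
    intro h
    apply hjn
    apply Fin.ext
    rw [Fin.val_add, h1v, Fin.val_zero, ← hd, h, Nat.mod_self]
  have hd0 : d ≠ 0 := by
    intro h
    have : j = 0 := Fin.ext h
    rw [this] at hchord
    exact hchord.ne rfl
  -- the `ℕ`-indexed reading of `c`, with `q (n + 1) = c 0`
  obtain ⟨q, hq, hqn1⟩ :
      ∃ q : ℕ → V, (∀ m (h : m < n + 1), q m = c ⟨m, h⟩) ∧ q (n + 1) = c 0 :=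
    ⟨fun m => if h : m < n + 1 then c ⟨m, h⟩ else c 0, fun m h => dif_pos h,
      dif_neg (lt_irrefl _)⟩
  have hq0 : q 0 = c 0 := hq 0 (by omega)
  have hqj : q d = c j := hq d hdn
  have hrot : ∀ (a : ℕ) (ha : a < n + 1),
      ((finRotate (n + 1) ⟨a, ha⟩ : Fin (n + 1)) : ℕ) = if a + 1 = n + 1 then 0 else a + 1 :=
    fun a ha => val_finRotate ⟨a, ha⟩
  -- consecutive vertices are adjacent (in `H − uv`, hence in `H`)
  have hadjH' : ∀ m, m ≤ n → (H.deleteEdges {s(u, v)}).Adj (q m) (q (m + 1)) := by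
    intro m hm
    have h := hc.adj_next ⟨m, by omega⟩
    rw [hq m (by omega)]
    by_cases hmn : m = n
    · subst hmn
      rw [hqn1]
      have : finRotate (m + 1) ⟨m, by omega⟩ = 0 :=
        Fin.ext (by rw [hrot m (by omega), if_pos rfl, Fin.val_zero])
      rwa [this] at h
    · rw [hq (m + 1) (by omega)]
      have : finRotate (n + 1) ⟨m, by omega⟩ = ⟨m + 1, by omega⟩ :=
        Fin.ext (by rw [hrot m (by omega), if_neg (by omega)])
      rwa [this] at h
  have hadjH : ∀ m, m ≤ n → H.Adj (q m) (q (m + 1)) := fun m hm =>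
    SimpleGraph.deleteEdges_le _ (hadjH' m hm)
  -- distinct positions carry distinct vertices
  have hinj : ∀ a b, a < n + 1 → b < n + 1 → q a = q b → a = b := by
    intro a b ha hb h
    rw [hq a ha, hq b hb] at h
    exact Fin.mk.inj_iff.mp (hc.injective h)
  -- non-consecutive positions are non-adjacent in `H − uv`
  have hnoH' : ∀ a b, a < b → b < n + 1 → b ≠ a + 1 → ¬ (a = 0 ∧ b = n) →
      ¬ (H.deleteEdges {s(u, v)}).Adj (q a) (q b) := by
    intro a b hab hb hb1 habn h
    rw [hq a (by omega), hq b hb] at h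
    rcases hc.no_chord h with h' | h'
    · have hb' : b = if a + 1 = n + 1 then 0 else a + 1 := by
        have := congrArg Fin.val h'
        rwa [hrot] at this
      split_ifs at hb' <;> omega
    · have ha' : a = if b + 1 = n + 1 then 0 else b + 1 := by
        have := congrArg Fin.val h'
        rwa [hrot] at this
      split_ifs at ha' <;> omega
  -- hence the chord `{q 0, q d}` is the deleted edge `uv` ...
  have hne0d : ¬ (H.deleteEdges {s(u, v)}).Adj (q 0) (q d) :=
    hnoH' 0 d (by omega) hdn (by omega) (by omega)
  have hsuv : s(q 0, q d) = s(u, v) := by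
    by_contra h
    exact hne0d (deleteEdges_singleton_adj.2 ⟨by rw [hq0, hqj]; exact hchord, h⟩)
  -- ... and it is the ONLY `H`-chord of the cycle
  have hP : ∀ a b, a < b → b < n + 1 → b ≠ a + 1 → ¬ (a = 0 ∧ b = n) →
      H.Adj (q a) (q b) → a = 0 ∧ b = d := by
    intro a b hab hb hb1 habn h
    have hs : s(q a, q b) = s(u, v) := by
      by_contra hs
      exact hnoH' a b hab hb hb1 habn (deleteEdges_singleton_adj.2 ⟨h, hs⟩)
    rw [← hsuv, Sym2.eq_iff] at hs
    rcases hs with ⟨h1, h2⟩ | ⟨-, h2⟩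
    · exact ⟨hinj a 0 (by omega) (by omega) h1, hinj b d hb hdn h2⟩
    · exact absurd (hinj b 0 hb (by omega) h2) (by omega)
  -- the arc `q 0, q 1, …, q d` closes up (by the chord) to a cycle of `H` without chords:
  -- so `d = 2`
  have hd2 : d = 2 := by
    by_contra hd2
    refine hH _ (isChordlessCycle_of_nat (n := d + 1) (q := q) (by omega) ?_ ?_ ?_ ?_)
    · intro a b ha hb h
      exact hinj a b (by omega) (by omega) h
    · intro a ha
      exact hadjH a (by omega)
    · rw [Nat.add_sub_cancel, hq0, hqj]
      exact hchord.symm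
    · intro a b hab hb hnot h
      rw [Nat.add_sub_cancel] at hnot
      exact hnot (hP a b (by omega) (by omega) (by omega) (by omega) h)
  -- likewise the arc `q d, q (d+1), …, q n, q (n+1) = q 0`: so `n + 1 - d = 2`
  have hn3 : n = 3 := by
    by_contra hn3
    refine hH _ (isChordlessCycle_of_nat (n := n + 2 - d) (q := fun m => q (d + m)) (by omega)
      ?_ ?_ ?_ ?_)
    · intro a b ha hb h
      by_cases ha' : d + a = n + 1 <;> by_cases hb' : d + b = n + 1
      · omega
      · rw [ha', hqn1, ← hq0] at h
        have := hinj 0 (d + b) (by omega) (by omega) h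
        omega
      · rw [hb', hqn1, ← hq0] at h
        have := hinj (d + a) 0 (by omega) (by omega) h
        omega
      · exact Nat.add_left_cancel (hinj _ _ (by omega) (by omega) h)
    · intro a ha
      show H.Adj (q (d + a)) (q (d + (a + 1)))
      rw [← add_assoc]
      exact hadjH (d + a) (by omega)
    · show H.Adj (q (d + (n + 2 - d - 1))) (q (d + 0))
      rw [show d + (n + 2 - d - 1) = n + 1 by omega, add_zero, hqn1, hqj]
      exact hchord
    · intro a b hab hb hnot h
      by_cases hb' : d + b = n + 1
      · rw [hb', hqn1, ← hq0] at h
        have := (hP 0 (d + a) (by omega) (by omega) (by omega) (by omega) h.symm).2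
        exact hnot ⟨by omega, by omega⟩
      · have := (hP (d + a) (d + b) (by omega) (by omega) (by omega) (by omega) h).1
        omega
  -- so `c` is a `4`-cycle `q 0, q 1, q 2 = q d, q 3` of `H` whose only chord is `{q 0, q 2} = uv`:
  -- `q 1, q 3` are non-adjacent common neighbours of `u` and `v`
  have h01 : H.Adj (q 0) (q 1) := hadjH 0 (by omega)
  have h12 : H.Adj (q 1) (q d) := by rw [hd2]; exact hadjH 1 (by omega)
  have h23 : H.Adj (q d) (q 3) := by rw [hd2]; exact hadjH 2 (by omega)
  have h30 : H.Adj (q 3) (q 0) := by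
    have := hadjH n le_rfl
    rw [hqn1, ← hq0, hn3] at this
    exact this
  have h13 : q 1 ≠ q 3 := fun h => absurd (hinj 1 3 (by omega) (by omega) h) (by omega)
  have hH13 : H.Adj (q 1) (q 3) := by
    rcases Sym2.eq_iff.mp hsuv with ⟨h0, h2⟩ | ⟨h0, h2⟩
    · subst h0 h2
      exact hclique h01 h12.symm h30.symm h23 h13
    · subst h0 h2
      exact hclique h12.symm h01 h23 h30.symm h13
  exact absurd (hP 1 3 (by omega) (by omega) (by omega) (by omega) hH13).1 (by omega)

/-- If `H` is chordal and the common neighbours of `u` and `v` are pairwise adjacent, then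
`H − uv` is chordal. [cite: RoseTarjanLueker1976, §2 Thm 2 (proof; p. 9 of the report)] -/
theorem IsChordal.deleteEdges_of_forall_adj (hH : IsChordal H)
    (hclique : ∀ ⦃x y⦄, H.Adj u x → H.Adj v x → H.Adj u y → H.Adj v y → x ≠ y → H.Adj x y) :
    IsChordal (H.deleteEdges {s(u, v)}) := by
  intro k c hc
  have hk := hc.four_le
  obtain ⟨n, rfl⟩ : ∃ n, k = n + 1 := ⟨k - 1, by omega⟩
  -- `c` is a cycle of the chordal graph `H`, so it has an `H`-chord `{c i, c j}`
  obtain ⟨i, j, hij, hj, hi⟩ :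
      ∃ i j, H.Adj (c i) (c j) ∧ j ≠ finRotate _ i ∧ i ≠ finRotate _ j := by
    by_contra h
    push Not at h
    refine hH c ⟨hk, hc.injective, fun m => SimpleGraph.deleteEdges_le _ (hc.adj_next m), ?_⟩
    intro a b hab
    by_cases h1 : b = finRotate _ a
    · exact Or.inl h1
    · exact Or.inr (h a b hab h1)
  -- rotate the cycle so that the chord starts at position `0`
  have hchord : H.Adj (c ((0 : Fin (n + 1)) + i)) (c ((j - i) + i)) := by
    rwa [zero_add, sub_add_cancel]
  refine deleteEdges_aux hH (hc.rotate i) hchord ?_ ?_ hclique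
  · intro h1
    apply hj
    rw [finRotate_apply]
    calc j = j - i + i := (sub_add_cancel j i).symm
      _ = 1 + i := by rw [h1]
      _ = i + 1 := add_comm 1 i
  · intro h1
    apply hi
    rw [finRotate_apply]
    calc i = 0 + i := (zero_add i).symm
      _ = j - i + 1 + i := by rw [h1]
      _ = j - i + i + 1 := add_right_comm _ _ _
      _ = j + 1 := by rw [sub_add_cancel]

/-- Conversely: if `uv ∈ E(H)` and `H − uv` is chordal then the common neighbours of `u` and `v`
are pairwise adjacent — otherwise `u, x, v, y` is a chordless `4`-cycle of `H − uv`.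
[cite: RoseTarjanLueker1976, §2 Thm 2 (proof; p. 9 of the report)] -/
theorem forall_adj_of_isChordal_deleteEdges (huv : H.Adj u v)
    (h : IsChordal (H.deleteEdges {s(u, v)})) :
    ∀ ⦃x y⦄, H.Adj u x → H.Adj v x → H.Adj u y → H.Adj v y → x ≠ y → H.Adj x y := by
  intro x y hux hvx huy hvy hxy
  by_contra hnxy
  have hux' := hux.ne
  have hvx' := hvx.ne
  have huy' := huy.ne
  have hvy' := hvy.ne
  have huv' := huv.ne
  -- the `4`-cycle `u, x, v, y`
  let q : ℕ → V := fun m => if m = 0 then u else if m = 1 then x else if m = 2 then v else y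
  have hq0 : q 0 = u := by simp [q]
  have hq1 : q 1 = x := by simp [q]
  have hq2 : q 2 = v := by simp [q]
  have hq3 : q 3 = y := by simp [q]
  have h01 : (H.deleteEdges {s(u, v)}).Adj (q 0) (q 1) := by
    rw [hq0, hq1]
    refine deleteEdges_singleton_adj.2 ⟨hux, fun h => ?_⟩
    rcases Sym2.eq_iff.mp h with ⟨-, h⟩ | ⟨h, -⟩
    exacts [hvx' h.symm, huv' h]
  have h12 : (H.deleteEdges {s(u, v)}).Adj (q 1) (q 2) := by
    rw [hq1, hq2]
    refine deleteEdges_singleton_adj.2 ⟨hvx.symm, fun h => ?_⟩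
    rcases Sym2.eq_iff.mp h with ⟨h, -⟩ | ⟨h, -⟩
    exacts [hux' h.symm, hvx' h.symm]
  have h23 : (H.deleteEdges {s(u, v)}).Adj (q 2) (q 3) := by
    rw [hq2, hq3]
    refine deleteEdges_singleton_adj.2 ⟨hvy, fun h => ?_⟩
    rcases Sym2.eq_iff.mp h with ⟨h, -⟩ | ⟨-, h⟩
    exacts [huv' h.symm, huy' h.symm]
  have h30 : (H.deleteEdges {s(u, v)}).Adj (q 3) (q 0) := by
    rw [hq3, hq0]
    refine deleteEdges_singleton_adj.2 ⟨huy.symm, fun h => ?_⟩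
    rcases Sym2.eq_iff.mp h with ⟨h, -⟩ | ⟨h, -⟩
    exacts [huy' h.symm, hvy' h.symm]
  have h02 : ¬ (H.deleteEdges {s(u, v)}).Adj (q 0) (q 2) := by
    rw [hq0, hq2]
    exact fun h => (deleteEdges_singleton_adj.1 h).2 rfl
  have h13 : ¬ (H.deleteEdges {s(u, v)}).Adj (q 1) (q 3) := by
    rw [hq1, hq3]
    exact fun h => hnxy (SimpleGraph.deleteEdges_le _ h)
  refine h _ (isChordlessCycle_of_nat (n := 4) (q := q) le_rfl ?_ ?_ h30 ?_)
  · -- distinct vertices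
    have hxy' : x ≠ y := hxy
    intro i j hi hj hqij
    interval_cases i <;> interval_cases j <;>
      first
      | rfl
      | (simp only [hq0, hq1, hq2, hq3] at hqij
         first | exact absurd hqij ‹_› | exact absurd hqij.symm ‹_›)
  · intro i hi
    have hi' : i < 3 := by omega
    interval_cases i
    exacts [h01, h12, h23]
  · intro i j hij hj hnot
    have hi : i < 3 := by omega
    interval_cases i <;> interval_cases j <;> first | (exfalso; omega) | exact h02 | exact h13

/-- `uv` is THE UNIQUE CHORD OF A `4`-CYCLE of `H`: `uv ∈ E(H)` and there are vertices `x ≠ y`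
with `u — x — v — y — u` a cycle of `H` and `xy ∉ E(H)` ("`e` is the unique chord of a `4`-cycle
in `G*_α`"). [cite: RoseTarjanLueker1976, §2 Thm 2 (p. 9 of the report)] -/
def IsUniqueChordOfFourCycle (H : _root_.SimpleGraph V) (u v : V) : Prop :=
  H.Adj u v ∧ ∃ x y, x ≠ y ∧ H.Adj u x ∧ H.Adj x v ∧ H.Adj v y ∧ H.Adj y u ∧ ¬ H.Adj x y

/-- The notion is symmetric in `u`, `v`.
[cite: RoseTarjanLueker1976, §2 Thm 2 (p. 9 of the report)] -/
theorem IsUniqueChordOfFourCycle.symm (h : IsUniqueChordOfFourCycle H u v) :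
    IsUniqueChordOfFourCycle H v u := by
  obtain ⟨huv, x, y, hxy, hux, hxv, hvy, hyu, hnxy⟩ := h
  exact ⟨huv.symm, x, y, hxy, hxv.symm, hux.symm, hyu.symm, hvy.symm, hnxy⟩

/-- **The single-edge deletion criterion** [RTL76, proof of Thm 2]: for an edge `uv` of a
chordal graph `H`, the graph `H − uv` is chordal iff `uv` is NOT the unique chord of a `4`-cycle
of `H`. [cite: RoseTarjanLueker1976, §2 Thm 2 (proof; p. 9 of the report)] -/
theorem IsChordal.isChordal_deleteEdges_iff (hH : IsChordal H) (huv : H.Adj u v) :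
    IsChordal (H.deleteEdges {s(u, v)}) ↔ ¬ IsUniqueChordOfFourCycle H u v := by
  constructor
  · rintro h ⟨-, x, y, hxy, hux, hxv, hvy, hyu, hnxy⟩
    exact hnxy (forall_adj_of_isChordal_deleteEdges huv h hux hxv.symm hyu.symm hvy hxy)
  · intro h
    refine hH.deleteEdges_of_forall_adj fun x y hux hvx huy hvy hxy => ?_
    by_contra hnxy
    exact h ⟨huv, x, y, hxy, hux, hvx.symm, hvy, huy.symm, hnxy⟩

end DeleteEdge

/-! ### Adding the deficiency of a vertex: Lemma 1 and Corollary 1 -/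

section Deficiency

/-- The graph `G + D(x)` obtained from `G` by adding the DEFICIENCY
`D(x) = {{y, z} | x—y, x—z, y ≠ z, y ⌿ z}` of the vertex `x`, i.e. by making the neighbourhood
of `x` complete ("the graph `G' = (V, E ∪ D(x))`"); its restriction to `V − {x}` is the
`x`-ELIMINATION GRAPH `G_x = (V − {x}, E(V − {x}) ∪ D(x))`.
[cite: RoseTarjanLueker1976, §1 (p. 3 of the report); §2 Lemma 1 (p. 7)] -/
def addDeficiency (G : _root_.SimpleGraph V) (x : V) : _root_.SimpleGraph V where
  Adj y z := G.Adj y z ∨ (y ≠ z ∧ G.Adj x y ∧ G.Adj x z)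
  symm := ⟨fun y z (h : G.Adj y z ∨ (y ≠ z ∧ G.Adj x y ∧ G.Adj x z)) =>
    h.elim (fun h => Or.inl h.symm) fun h => Or.inr ⟨h.1.symm, h.2.2, h.2.1⟩⟩
  loopless := ⟨fun y (h : G.Adj y y ∨ (y ≠ y ∧ G.Adj x y ∧ G.Adj x y)) =>
    h.elim (fun h => h.ne rfl) fun h => h.1 rfl⟩

variable {x : V}

/-- Adjacency in `G + D(x)`. [cite: RoseTarjanLueker1976, §1 (p. 3 of the report)] -/
theorem addDeficiency_adj {y z : V} :
    (addDeficiency G x).Adj y z ↔ G.Adj y z ∨ (y ≠ z ∧ G.Adj x y ∧ G.Adj x z) := Iff.rfl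

/-- `G ⊆ G + D(x)`. [cite: RoseTarjanLueker1976, §1 (p. 3 of the report)] -/
theorem le_addDeficiency (G : _root_.SimpleGraph V) (x : V) : G ≤ addDeficiency G x :=
  fun _ _ h => Or.inl h

/-- The added edges are not incident to `x`: `adj_{G + D(x)}(x) = adj_G(x)`.
[cite: RoseTarjanLueker1976, §1 (p. 3 of the report)] -/
theorem addDeficiency_adj_self {y : V} : (addDeficiency G x).Adj x y ↔ G.Adj x y :=
  ⟨fun h => h.elim id fun h => absurd h.2.1 G.irrefl, fun h => Or.inl h⟩

/-- `x` is simplicial in `G + D(x)` (this is the point of eliminating `x`).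
[cite: RoseTarjanLueker1976, §1 (p. 3 of the report)] -/
theorem isSimplicial_addDeficiency (G : _root_.SimpleGraph V) (x : V) :
    IsSimplicial (addDeficiency G x) x := fun _ _ hy hz hyz =>
  Or.inr ⟨hyz, addDeficiency_adj_self.1 hy, addDeficiency_adj_self.1 hz⟩

/-- If `x` is simplicial in a supergraph `H ⊇ G` then `G + D(x) ⊆ H`.
[cite: RoseTarjanLueker1976, §2 (proof of Lemma 2, p. 8 of the report)] -/
theorem addDeficiency_le_of_isSimplicial (hGH : G ≤ H) (hx : IsSimplicial H x) :
    addDeficiency G x ≤ H := fun _ _ h =>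
  h.elim (fun h => hGH h) fun h => hx (hGH h.2.1) (hGH h.2.2) h.1

/-- `G + D(x) = G` when `x` is simplicial in `G` (`D(x) = ∅`).
[cite: RoseTarjanLueker1976, §1 (p. 3 of the report)] -/
theorem addDeficiency_eq_self_of_isSimplicial (hx : IsSimplicial G x) : addDeficiency G x = G :=
  le_antisymm (addDeficiency_le_of_isSimplicial le_rfl hx) (le_addDeficiency G x)

/-- **[RTL76, Lemma 1].** A perfect elimination ordering of `G` is also one of
`G' = (V, E ∪ D(x))`: if `G.Adj` is monotone transitive w.r.t. a linear order then so is
`(G + D(x)).Adj` ("if `G` is triangulated, then `G'` is triangulated").  Proof as in the report: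
for `y < w, z` with `yw ∈ E` and `yz ∈ D(x)`, either `x < y` (then `yz ∈ E` after all, by
monotone transitivity at `x`) or `y < x` (then `xw ∈ E` by monotone transitivity at `y`, so
`wz ∈ E ∪ D(x)`). [cite: RoseTarjanLueker1976, §2 Lemma 1 (pp. 7–8 of the report)] -/
theorem monotoneTransitive_addDeficiency [LinearOrder V] (hG : MonotoneTransitive G.Adj) (x : V) :
    MonotoneTransitive (addDeficiency G x).Adj := by
  -- the mixed case, used twice
  have key : ∀ ⦃y w z : V⦄, y < w → y < z → w ≠ z → G.Adj y w →
      (y ≠ z ∧ G.Adj x y ∧ G.Adj x z) → (addDeficiency G x).Adj w z := by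
    rintro y w z hyw hyz hwz h1 ⟨-, hxy, hxz⟩
    by_cases hwx : w = x
    · subst hwx
      exact Or.inl hxz
    rcases lt_or_gt_of_ne hxy.ne with hlt | hgt
    · -- `x < y`: then `y, z ∈ adj⁺(x)`, so `yz ∈ E`
      have hyz' : G.Adj y z := hG hlt (hlt.trans hyz) hyz.ne hxy hxz
      exact Or.inl (hG hyw hyz hwz h1 hyz')
    · -- `y < x`: then `x, w ∈ adj⁺(y)`, so `xw ∈ E` and `wz ∈ D(x) ∪ E`
      exact Or.inr ⟨hwz, hG hgt hyw (fun h => hwx h.symm) hxy.symm h1, hxz⟩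
  intro y w z hyw hyz hwz h1 h2
  rcases h1 with h1 | h1 <;> rcases h2 with h2 | h2
  · exact Or.inl (hG hyw hyz hwz h1 h2)
  · exact key hyw hyz hwz h1 h2
  · exact (key hyz hyw hwz.symm h2 h1).symm
  · exact Or.inr ⟨hwz, h1.2.2, h2.2.2⟩

/-- **[RTL76, Lemma 1 / Cor. 1]** on the whole vertex set: if `G` is chordal then so is
`G + D(x)`. [cite: RoseTarjanLueker1976, §2 Lemma 1 (pp. 7–8 of the report)] -/
theorem isChordal_addDeficiency [Finite V] (hG : IsChordal G) (x : V) :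
    IsChordal (addDeficiency G x) := by
  obtain ⟨o, ho⟩ := isChordal_iff_exists_linearOrder_monotoneTransitive'.mp hG
  letI := o
  exact isChordal_of_monotoneTransitive (monotoneTransitive_addDeficiency ho x)

/-- **[RTL76, Corollary 1].** If `G` is chordal then the elimination graph
`G_x = (V − {x}, E(V − {x}) ∪ D(x))` is chordal, for every vertex `x`.
[cite: RoseTarjanLueker1976, §2 Cor. 1 (p. 8 of the report)] -/
theorem IsChordal.eliminationGraph [Finite V] (hG : IsChordal G) (x : V) :
    IsChordal ((addDeficiency G x).induce {x}ᶜ) :=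
  (isChordal_addDeficiency hG x).induce _

/-- A vertex simplicial in `G` stays simplicial in `G + D(z)` (used in the proof of
[RTL76, Lemma 2], case (ii)).
[cite: RoseTarjanLueker1976, §2 Lemma 2 (proof, p. 8 of the report)] -/
theorem isSimplicial_addDeficiency_of_isSimplicial {r : V} (hr : IsSimplicial G r) (z : V) :
    IsSimplicial (addDeficiency G z) r := by
  have key : ∀ ⦃a b : V⦄, a ≠ b → G.Adj r a → (r ≠ b ∧ G.Adj z r ∧ G.Adj z b) →
      (addDeficiency G z).Adj a b := by
    rintro a b hab hra ⟨-, hzr, hzb⟩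
    by_cases haz : a = z
    · subst haz
      exact Or.inl hzb
    · exact Or.inr ⟨hab, (hr hra hzr.symm haz).symm, hzb⟩
  intro a b hra hrb hab
  rcases hra with hra | hra <;> rcases hrb with hrb | hrb
  · exact Or.inl (hr hra hrb hab)
  · exact key hab hra hrb
  · exact (key hab.symm hrb hra).symm
  · exact Or.inr ⟨hab, hra.2.2, hrb.2.2⟩

end Deficiency

/-! ### Simplicial vertices, induced subgraphs and edge deletion -/

/-- Iterates of `finRotate k` move every point when `k ≥ 4`. [folklore] -/
private theorem finRotate_ne {k : ℕ} (hk : 4 ≤ k) (m : Fin k) :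
    finRotate k m ≠ m ∧ finRotate k (finRotate k m) ≠ m ∧
      finRotate k (finRotate k (finRotate k m)) ≠ m := by
  have hm := m.isLt
  refine ⟨fun h => ?_, fun h => ?_, fun h => ?_⟩ <;>
  · have h' := congrArg Fin.val h
    simp only [val_finRotate] at h'
    split_ifs at h' <;> omega

/-- A graph with a simplicial vertex `x` is chordal as soon as `H − x` is: a chordless cycle
through `x` would have its two neighbours of `x` adjacent (the last step of the proof of
[RTL76, Lemma 2]: "`G' − f` is triangulated since `f ∉ D(x)`", `x` simplicial in `G'` and
`G'_x − f` triangulated). [cite: RoseTarjanLueker1976, §2 Lemma 2 (proof, p. 9 of the report)] -/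
theorem isChordal_of_isSimplicial_of_induce_compl {x : V} (hx : IsSimplicial H x)
    (h : IsChordal (H.induce {x}ᶜ)) : IsChordal H := by
  intro k c hc
  have hk := hc.four_le
  by_cases hxc : ∃ i, c i = x
  · obtain ⟨i, rfl⟩ := hxc
    obtain ⟨-, h2, h3⟩ := finRotate_ne hk ((finRotate k).symm i)
    rw [Equiv.apply_symm_apply] at h2 h3
    -- the two neighbours of `x = c i` on the cycle are adjacent ...
    have hprev : H.Adj (c ((finRotate k).symm i)) (c i) := by
      have := hc.adj_next ((finRotate k).symm i)
      rwa [Equiv.apply_symm_apply] at this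
    have hadj : H.Adj (c ((finRotate k).symm i)) (c (finRotate k i)) :=
      hx hprev.symm (hc.adj_next i) fun heq => h2 (hc.injective heq).symm
    -- ... which is a chord
    rcases hc.no_chord hadj with h' | h'
    · rw [Equiv.apply_symm_apply] at h'
      exact (finRotate_ne hk i).1 h'
    · exact h3 h'.symm
  · push Not at hxc
    have hmem : ∀ i, c i ∈ ({x}ᶜ : Set V) := fun i => Set.mem_compl_singleton_iff.mpr (hxc i)
    exact h (fun i => ⟨c i, hmem i⟩) ⟨hk, fun i j hij => hc.injective (congrArg Subtype.val hij),
      fun i => hc.adj_next i, fun i j hij => hc.no_chord hij⟩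

/-- Deleting an edge at `x` does not change `H − x`. [folklore] -/
private theorem induce_compl_deleteEdges (w x : V) :
    (H.deleteEdges {s(w, x)}).induce {x}ᶜ = H.induce {x}ᶜ := by
  ext p q
  rw [SimpleGraph.induce_adj, SimpleGraph.induce_adj, deleteEdges_singleton_adj]
  constructor
  · exact fun h => h.1
  · intro h
    refine ⟨h, fun heq => ?_⟩
    rcases Sym2.eq_iff.mp heq with ⟨-, h'⟩ | ⟨h', -⟩
    · exact (Set.mem_compl_singleton_iff.mp q.2) h'
    · exact (Set.mem_compl_singleton_iff.mp p.2) h'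

/-- Deleting an edge inside `s` commutes with inducing on `s`. [folklore] -/
private theorem induce_deleteEdges {s : Set V} (a b : s) :
    (H.deleteEdges {s((a : V), (b : V))}).induce s = (H.induce s).deleteEdges {s(a, b)} := by
  ext p q
  rw [SimpleGraph.induce_adj, deleteEdges_singleton_adj, deleteEdges_singleton_adj,
    SimpleGraph.induce_adj]
  simp only [Ne, Sym2.eq_iff, Subtype.ext_iff]

/-! ### Lemma 2 and Theorems 1 and 2 -/

/-- **[RTL76, Lemma 2].** If `G ⊊ H` are chordal graphs on the same (finite) vertex set, then
some edge of `H` not in `G` can be deleted from `H` keeping it chordal ("Let `G = (V,E)` be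
triangulated, and let `G_F = (V, E ∪ F)` with `F ≠ ∅` be triangulated.  Then there is some edge
`e ∈ F` such that `(V, E ∪ F − {e})` is triangulated").  Proof as in the report, by induction on
`|V|`: if some such edge is incident to a simplicial vertex `x` of `H`, delete it; otherwise pick a
simplicial `x` of `H` with an `H ∖ G` edge outside `D_G(x)` (if every such edge lies in `D_G(z)`
for the Dirac simplicial vertex `z` of `H`, then `H = G + D(z)` and a simplicial vertex of `G`
does it), pass to the elimination graphs `G_x ⊆ H_x = H − x` (chordal by Cor. 1), and lift the
edge given by induction. [cite: RoseTarjanLueker1976, §2 Lemma 2 (p. 8 of the report)] -/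
theorem IsChordal.exists_isChordal_deleteEdges [Finite V] (hG : IsChordal G) (hH : IsChordal H)
    (hGH : G ≤ H) (hne : G ≠ H) :
    ∃ u v, H.Adj u v ∧ ¬ G.Adj u v ∧ IsChordal (H.deleteEdges {s(u, v)}) := by
  -- strong induction on the number of vertices, over all vertex types in the universe of `V`
  suffices aux : ∀ (n : ℕ) (W : Type u) [Finite W], Nat.card W = n →
      ∀ G H : _root_.SimpleGraph W, IsChordal G → IsChordal H → G ≤ H → G ≠ H →
        ∃ u v, H.Adj u v ∧ ¬ G.Adj u v ∧ IsChordal (H.deleteEdges {s(u, v)}) from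
    aux _ V rfl G H hG hH hGH hne
  intro n
  refine Nat.strong_induction_on n fun n ih => ?_
  intro W _ hn G H hG hH hGH hne
  classical
  rcases isEmpty_or_nonempty W with hW | hW
  · exact absurd (SimpleGraph.ext (funext fun a => isEmptyElim a)) hne
  by_cases h1 : ∃ x w, IsSimplicial H x ∧ H.Adj w x ∧ ¬ G.Adj w x
  · -- Case (i): an edge `wx ∈ H ∖ G` at a simplicial vertex `x` of `H` can be deleted:
    -- `x` stays simplicial in `H − wx` and `(H − wx) − x = H − x` is chordal
    obtain ⟨x, w, hx, hwx, hGwx⟩ := h1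
    refine ⟨w, x, hwx, hGwx, isChordal_of_isSimplicial_of_induce_compl (x := x) ?_ ?_⟩
    · intro a b ha hb hab
      rw [deleteEdges_singleton_adj] at ha hb ⊢
      refine ⟨hx ha.1 hb.1 hab, fun heq => ?_⟩
      rcases Sym2.eq_iff.mp heq with ⟨-, h⟩ | ⟨h, -⟩
      · exact hb.1.ne h.symm
      · exact ha.1.ne h.symm
    · rw [induce_compl_deleteEdges]
      exact hH.induce _
  · -- Case (ii): no edge of `H ∖ G` is incident to a simplicial vertex of `H`
    push Not at h1
    -- a simplicial vertex `x` of `H` together with an edge `ab ∈ H ∖ G` outside `D_G(x)`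
    obtain ⟨x, hx, a, b, hab, hGab, hxab⟩ : ∃ x, IsSimplicial H x ∧
        ∃ a b, H.Adj a b ∧ ¬ G.Adj a b ∧ ¬ (G.Adj x a ∧ G.Adj x b) := by
      obtain ⟨a, b, hab, hGab⟩ : ∃ a b, H.Adj a b ∧ ¬ G.Adj a b := by
        by_contra h
        push Not at h
        exact hne (le_antisymm hGH fun a b hab => h a b hab)
      obtain ⟨z, hz⟩ := hH.exists_isSimplicial
      by_cases hzD : ∀ a b, H.Adj a b → ¬ G.Adj a b → G.Adj z a ∧ G.Adj z b
      · -- every edge of `H ∖ G` lies in `D_G(z)`: then `H = G + D(z)`, and a simplicial vertex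
        -- `r` of `G` is simplicial in `H` and has `ab ∉ D_G(r)` (else `ab ∈ E(G)`)
        have hHeq : H = addDeficiency G z := by
          ext a b
          constructor
          · intro h
            by_cases hG' : G.Adj a b
            · exact Or.inl hG'
            · exact Or.inr ⟨h.ne, hzD a b h hG'⟩
          · rintro (h | ⟨hne', hza, hzb⟩)
            · exact hGH h
            · exact hz (hGH hza) (hGH hzb) hne'
        obtain ⟨r, hr⟩ := hG.exists_isSimplicial
        exact ⟨r, hHeq ▸ isSimplicial_addDeficiency_of_isSimplicial hr z, a, b, hab, hGab,
          fun h => hGab (hr h.1 h.2 hab.ne)⟩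
      · push Not at hzD
        obtain ⟨a, b, hab, hGab, h⟩ := hzD
        exact ⟨z, hz, a, b, hab, hGab, fun h' => h h'.1 h'.2⟩
    -- the neighbourhood of `x` is the same in `G` and `H`
    have hNx : ∀ w, H.Adj x w → G.Adj x w := fun w h => (h1 x w hx h.symm).symm
    have hax : a ≠ x := by
      rintro rfl
      exact hGab (hNx b hab)
    have hbx : b ≠ x := by
      rintro rfl
      exact hGab (hNx a hab.symm).symm
    -- descend to the `x`-elimination graphs `G_x ⊆ H_x = H − x` on fewer vertices
    have hxs : x ∉ ({x}ᶜ : Set W) := fun h => h rfl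
    have has : a ∈ ({x}ᶜ : Set W) := Set.mem_compl_singleton_iff.mpr hax
    have hbs : b ∈ ({x}ᶜ : Set W) := Set.mem_compl_singleton_iff.mpr hbx
    have hADle : addDeficiency G x ≤ H := addDeficiency_le_of_isSimplicial hGH hx
    have hle₁ : (addDeficiency G x).induce ({x}ᶜ : Set W) ≤ H.induce {x}ᶜ := fun p q h => hADle h
    have hne₁ : (addDeficiency G x).induce ({x}ᶜ : Set W) ≠ H.induce {x}ᶜ := by
      intro heq
      have : ((addDeficiency G x).induce ({x}ᶜ : Set W)).Adj ⟨a, has⟩ ⟨b, hbs⟩ := by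
        rw [heq]
        exact hab
      rcases this with h | ⟨-, hxa, hxb⟩
      · exact hGab h
      · exact hxab ⟨hxa, hxb⟩
    have hcard : Nat.card ({x}ᶜ : Set W) < n := hn ▸ Finite.card_subtype_lt hxs
    obtain ⟨p, q, hpq, hGpq, hch⟩ := ih _ hcard _ rfl _ _ (hG.eliminationGraph x)
      (hH.induce {x}ᶜ) hle₁ hne₁
    -- lift the edge `pq` of `H − x` given by induction back to `H`
    refine ⟨p, q, hpq, fun h => hGpq (Or.inl h),
      isChordal_of_isSimplicial_of_induce_compl (x := x) ?_ ?_⟩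
    · -- `x` is simplicial in `H − pq` since `pq ∉ D_G(x) = D_H(x)` (`pq` is not even in `G_x`)
      intro c d hc hd hcd
      rw [deleteEdges_singleton_adj] at hc hd ⊢
      refine ⟨hx hc.1 hd.1 hcd, fun heq => hGpq ?_⟩
      have hxc : G.Adj x c := hNx c hc.1
      have hxd : G.Adj x d := hNx d hd.1
      rcases Sym2.eq_iff.mp heq with ⟨h1, h2⟩ | ⟨h1, h2⟩
      · subst h1 h2
        exact Or.inr ⟨hcd, hxc, hxd⟩
      · subst h1 h2
        exact Or.inr ⟨fun h => hcd h.symm, hxd, hxc⟩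
    · -- `(H − pq) − x = (H − x) − pq` is chordal by induction
      rw [induce_deleteEdges]
      exact hch

/-- **[RTL76, Theorem 1].** A triangulation `H` of `G` is minimal iff no single edge of `H ∖ G`
can be deleted keeping `H` chordal ("`F` is a minimal triangulation iff for each `e ∈ F`,
`(V, E ∪ F − {e})` is not triangulated").
[cite: RoseTarjanLueker1976, §2 Thm 1 (p. 9 of the report)] -/
theorem isMinimalTriangulation_iff_forall_not_isChordal_deleteEdges [Finite V] :
    IsMinimalTriangulation G H ↔
      IsTriangulation G H ∧
        ∀ ⦃u v⦄, H.Adj u v → ¬ G.Adj u v → ¬ IsChordal (H.deleteEdges {s(u, v)}) := by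
  rw [isMinimalTriangulation_iff]
  refine ⟨fun ⟨hT, hmin⟩ => ⟨hT, fun u v huv hGuv hch => ?_⟩, fun ⟨hT, hmin⟩ => ⟨hT, ?_⟩⟩
  · -- `H − uv` would be a triangulation strictly below `H`
    have hle : G ≤ H.deleteEdges {s(u, v)} := by
      intro a b hab
      rw [deleteEdges_singleton_adj]
      refine ⟨hT.le hab, fun heq => hGuv ?_⟩
      rcases Sym2.eq_iff.mp heq with ⟨h1, h2⟩ | ⟨h1, h2⟩
      · subst h1 h2
        exact hab
      · subst h1 h2
        exact hab.symm
    have heq := hmin hle (SimpleGraph.deleteEdges_le _) hch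
    have huv' : (H.deleteEdges {s(u, v)}).Adj u v := by
      rw [heq]
      exact huv
    exact (deleteEdges_singleton_adj.mp huv').2 rfl
  · -- Lemma 2
    intro H' hGH' hH'H hH'
    by_contra hne
    obtain ⟨u, v, huv, hH'uv, hch⟩ := hH'.exists_isChordal_deleteEdges hT.isChordal hH'H hne
    exact hmin huv (fun h => hH'uv (hGH' h)) hch

/-- **[RTL76, Theorem 2].** A triangulation `H` of `G` is minimal iff every edge of `H ∖ G` is
the unique chord of a `4`-cycle of `H` ("`α` is a minimal ordering iff each fill edge `e` is the
unique chord of a `4`-cycle in `G*_α`").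
[cite: RoseTarjanLueker1976, §2 Thm 2 (p. 9 of the report)] -/
theorem isMinimalTriangulation_iff_forall_isUniqueChordOfFourCycle [Finite V] :
    IsMinimalTriangulation G H ↔
      IsTriangulation G H ∧
        ∀ ⦃u v⦄, H.Adj u v → ¬ G.Adj u v → IsUniqueChordOfFourCycle H u v := by
  rw [isMinimalTriangulation_iff_forall_not_isChordal_deleteEdges]
  constructor
  · rintro ⟨hT, h⟩
    refine ⟨hT, fun u v huv hGuv => ?_⟩
    by_contra hn
    exact h huv hGuv ((hT.isChordal.isChordal_deleteEdges_iff huv).mpr hn)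
  · rintro ⟨hT, h⟩
    exact ⟨hT, fun u v huv hGuv hch =>
      (hT.isChordal.isChordal_deleteEdges_iff huv).mp hch (h huv hGuv)⟩

/-! ### Minimal triangulations and elimination graphs -/

/-- Every elimination graph `G*_σ` is a triangulation of `G` ("any elimination graph `G*_α` is
a perfect elimination graph, since `α` is a perfect ordering of this graph").
[cite: RoseTarjanLueker1976, §1 (p. 4 of the report)] -/
theorem isTriangulation_elimGraph [LinearOrder V] (G : _root_.SimpleGraph V) :
    IsTriangulation G (elimGraph G) :=
  ⟨le_elimGraph, isChordal_elimGraph⟩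

/-- Every minimal triangulation is an elimination graph: `H = G*_σ` for some ordering `σ` of the
vertices (a perfect elimination ordering of `H`) — so the minimal triangulations of `G` are
exactly the fills `F(G_α)` of the MINIMAL ORDERINGS `α`.
[cite: RoseTarjanLueker1976, §2 (p. 10 of the report, remark after Thm 2)] -/
theorem IsMinimalTriangulation.exists_linearOrder_eq_elimGraph [Finite V]
    (h : IsMinimalTriangulation G H) : ∃ o : LinearOrder V, H = @elimGraph V o.toLT G := by
  cases nonempty_fintype V
  obtain ⟨o, ho⟩ := h.1.isChordal.exists_linearOrder_elimGraph_le G h.1.le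
  exact ⟨o, ((isMinimalTriangulation_iff.mp h).2 (@le_elimGraph V o.toLT G) ho
    (@isChordal_elimGraph V o G)).symm⟩

section MinimalOrdering

variable [ord : LinearOrder V]

/-- The ordering `σ` of `V` is a MINIMAL (ELIMINATION) ORDERING of `G`: no ordering `β` has a
strictly smaller fill, `G*_β ⊊ G*_σ` ("`α` is a minimal ordering if no ordering `β` satisfies
`F(G_β) ⊂ F(G_α)`" (proper containment); not to be confused with a MINIMUM ordering,
`|F(G_α)|` least).  [cite: RoseTarjanLueker1976, §1 (p. 4 of the report)] -/
def IsMinimalOrdering (G : _root_.SimpleGraph V) : Prop :=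
  ∀ o : LinearOrder V, @elimGraph V o.toLT G ≤ @elimGraph V ord.toLT G →
    @elimGraph V o.toLT G = @elimGraph V ord.toLT G

/-- The ordering is minimal iff its elimination graph is a minimal triangulation ("`α` is a
minimal ordering iff `F(G_α)` is a minimal triangulation" — because every chordal supergraph
contains an elimination graph). [cite: RoseTarjanLueker1976, §2 (p. 10 of the report)] -/
theorem isMinimalOrdering_iff_isMinimalTriangulation [Finite V] :
    IsMinimalOrdering G ↔ IsMinimalTriangulation G (elimGraph G) := by
  cases nonempty_fintype V
  rw [isMinimalTriangulation_iff]
  constructor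
  · intro h
    refine ⟨isTriangulation_elimGraph G, fun H' hGH' hH'le hH' => le_antisymm hH'le ?_⟩
    obtain ⟨o, ho⟩ := hH'.exists_linearOrder_elimGraph_le G hGH'
    rw [← h o (ho.trans hH'le)]
    exact ho
  · rintro ⟨-, hmin⟩ o ho
    exact hmin (@le_elimGraph V o.toLT G) ho (@isChordal_elimGraph V o G)

/-- **[RTL76, Theorem 2]** verbatim: the ordering `α` is minimal iff each fill edge is the unique
chord of a `4`-cycle of `G*_α`. [cite: RoseTarjanLueker1976, §2 Thm 2 (p. 9 of the report)] -/
theorem isMinimalOrdering_iff_forall_isUniqueChordOfFourCycle [Finite V] :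
    IsMinimalOrdering G ↔
      ∀ ⦃u v⦄, (elimGraph G).Adj u v → ¬ G.Adj u v →
        IsUniqueChordOfFourCycle (elimGraph G) u v := by
  rw [isMinimalOrdering_iff_isMinimalTriangulation,
    isMinimalTriangulation_iff_forall_isUniqueChordOfFourCycle]
  exact ⟨fun h => h.2, fun h => ⟨isTriangulation_elimGraph G, h⟩⟩

end MinimalOrdering

end Literature.Combinatorics.SimpleGraph
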